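import Mathlib
import Literature.AlgebraicGeometry.Resolution.CobordantGame
import Literature.AlgebraicGeometry.Resolution.CobordantChartCoefficients
import Literature.AlgebraicGeometry.Resolution.CobordantTupleGame
import Literature.AlgebraicGeometry.Resolution.FormalCoordinateChange
import Summits.ResolutionOfSingularities.ResolutionOfSingularities.Theorems.WeightedInvariantLocalWeightedDropMonicPointBlowupSlot
import Summits.ResolutionOfSingularities.ResolutionOfSingularities.Theorems.WeightedInvariantLocalWeightedDropWildPurePowerDescentTwo
import Summits.ResolutionOfSingularities.ResolutionOfSingularities.Theorems.WeightedInvariantLocalWeightedDropWildMonicDescent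

/-!
# `WeightedInvariant.LocalWeightedDrop`, line `hasse-ridge-face-selection`: the DESCENT LIFT for general monic surface forms,
# SECOND FORM — the datum CHOOSES the live slot, and the `d`-fold plane `y^d` is an exit

Crux item stmt-ResolutionOfSingularities-8899 `LocalWeightedDrop` (route `ResolutionOfSingularities/WeightedInvariant`), engine of
the door `HypersurfaceCentreConstruction` stmt-ResolutionOfSingularities-19897.  [OURS · L1 W4.3, chain w43, res-type-083 (extra
seat S3ρ, CHAIN v4.3 D12).  RE-TYPE of the S3ρD interface after res-D-pv-005 AS res-L1-w43-stub-7 (2026-08-27T05:30:37Z)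
observed that the first form `WildMonic.wildMonicSurfaceReductionWon_of_descent` asks for a datum that cannot exist when `p ∣ d`,
`d ≠ p^e`: the zero tuple (the `d`-fold plane `y^d`) is a position with no terminal / pure exit and only wide successors.  Same
repair as stub-1's `WildPurePower.purePower_won_of_descent₂` for the pure forms.  Not a statement of any manuscript.]

`monic_won_of_descent₂`: as `monic_won_of_descent`, but (i) after its free moves the datum may also exit through the ZERO TUPLE
(`y^d` alone is won in one move, `WildPurePower.won_X_pow_last`), and (ii) at each exceptional point of the point blow-up the datum
CHOOSES the live slot `i₀` in which the successor is read (brick `won_monic_of_pointBlowup_slot`), instead of serving every live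
slot.  `wildMonicSurfaceReductionWon_of_descent₂`: S3ρ `stub_wildMonicSurfaceReductionWon` VERBATIM from a terminal predicate with
its winning theorem and a datum of the second form.
-/

set_option linter.dupNamespace false -- mandated namespace of this single-conjunct summit

namespace Summit.ResolutionOfSingularities.ResolutionOfSingularities.Theorems

open Literature.AlgebraicGeometry.Resolution
open Literature.AlgebraicGeometry.Resolution.CobordantGame

namespace WildMonic

open MvPowerSeries

variable {k : Type} [Field k] {m : ℕ}

/-! ### The descent lift, second form -/

/-- THE DESCENT LIFT FOR GENERAL MONIC SURFACE FORMS `y^d + Σ_{j<d} A_j(x₁,x₂) y^j` (`d ≥ 1`, `k` algebraically closed of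
characteristic `p`).  DATA: a type of STATES with coefficient tuples `germ s` and an ordinal MEASURE `μ`, and a caller-supplied
EXIT PREDICATE `T` on positions with its winning proof `hT` (terminal classes, hand-offs).  STEP PROPERTY demanded, for every state
whose tuple is a position (`ord A_j > d - j`): after a free PLANE CHANGE `θ` and a free RE-CENTRING `y ↦ y + φ(x)` (new position
`A₁ = shift d (A ∘ θ) φ`), EITHER `T A₁`, OR for every exceptional point of the POINT BLOW-UP (live slot `i₀`, chart-divided
coefficients `Bv`), whenever the successor slice `y^d + Σ_j (s Bv_j)| y^j` is singular of order `d` with a WIDE apex, every LINEAR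
re-centring `y ↦ y - Σ μ'_i x_i` that makes it a position is the tuple of a state of SMALLER measure.  CONCLUSION: every state's
monic form is won — the other successors are exits discharged here once and for all: order `< d` (`hord`), order `d` with a cone
that is not wide (`WildPurePower.won_of_order_eq_of_not_wide`: apex-free or axis), and the wide case re-centres linearly to a
position (`exists_linShift_isPos_of_wide`).  [OURS · L1 W4.3; tuple version of `WildPurePower.purePower_won_of_descent`.] -/
theorem monic_won_of_descent₂ (p : ℕ) (hp : p.Prime) (k : Type) [Field k] [CharP k p] [IsAlgClosed k] {d : ℕ} (hd : 0 < d)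
    (hord : ∀ g : MvPowerSeries (Fin 3) k, CobordantGame.IsSingular k g → g.order < d → CobordantGame.Won k 3 g)
    (haxis : ∀ g : MvPowerSeries (Fin 3) k, CobordantGame.IsSingular k g → g.order = d →
      (∃ c : Fin 3 → k, c ≠ 0 ∧ ∀ v : Fin 3 → k,
        CobordantChart.initEval (fun _ : Fin 3 => 1) (v + c) d g = CobordantChart.initEval (fun _ : Fin 3 => 1) v d g) →
      (∀ c₁ c₂ : Fin 3 → k,
        (∀ v : Fin 3 → k, CobordantChart.initEval (fun _ : Fin 3 => 1) (v + c₁) d g =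
          CobordantChart.initEval (fun _ : Fin 3 => 1) v d g) →
        (∀ v : Fin 3 → k, CobordantChart.initEval (fun _ : Fin 3 => 1) (v + c₂) d g =
          CobordantChart.initEval (fun _ : Fin 3 => 1) v d g) →
        ∃ α β : k, (α ≠ 0 ∨ β ≠ 0) ∧ α • c₁ + β • c₂ = 0) →
      CobordantGame.Won k 3 g)
    (T : (Fin d → MvPowerSeries (Fin 2) k) → Prop)
    (hT : ∀ A : Fin d → MvPowerSeries (Fin 2) k, (∀ j : Fin d, ((d - (j : ℕ) : ℕ) : ℕ∞) < (A j).order) → T A →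
      CobordantGame.Won k (2 + 1) ((X (Fin.last 2) : MvPowerSeries (Fin (2 + 1)) k) ^ d +
        ∑ j : Fin d, rename (Fin.succAboveEmb (Fin.last 2)) (A j) * X (Fin.last 2) ^ (j : ℕ)))
    {S : Type*} (germ : S → Fin d → MvPowerSeries (Fin 2) k) (μ : S → Ordinal.{0})
    (hstep : ∀ s : S, (∀ j : Fin d, ((d - (j : ℕ) : ℕ) : ℕ∞) < (germ s j).order) →
      ∃ (θ : Fin 2 → MvPowerSeries (Fin 2) k) (φ : MvPowerSeries (Fin 2) k),
        (∀ i, constantCoeff (θ i) = 0) ∧ IsUnit (FormalCoordChange.linMat θ).det ∧ constantCoeff φ = 0 ∧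
        (∀ j : Fin d, ((d - (j : ℕ) : ℕ) : ℕ∞) < (shift d (fun j => subst θ (germ s j)) φ j).order) ∧
        (T (shift d (fun j => subst θ (germ s j)) φ) ∨
          (∀ j : Fin d, shift d (fun j => subst θ (germ s j)) φ j = 0) ∨
          ∀ (c : Fin 2 → k), (∃ i, c i ≠ 0) → ∀ Bv : Fin d → MvPowerSeries (Fin (2 + 1)) k,
            (∀ j : Fin d, subst (CobordantChart.chart (fun _ : Fin 2 => 1) c) (shift d (fun j => subst θ (germ s j)) φ j) =
              X 0 ^ (d - (j : ℕ) + 1) * Bv j) →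
            ∃ i₀ : Fin 2, c i₀ ≠ 0 ∧
            (CobordantGame.IsSingular k ((X (Fin.last 2) : MvPowerSeries (Fin (2 + 1)) k) ^ d +
              ∑ j : Fin d, rename (Fin.succAboveEmb (Fin.last 2)) (TupleGame.slice i₀ (X 0 * Bv j)) *
                X (Fin.last 2) ^ (j : ℕ)) →
            ((X (Fin.last 2) : MvPowerSeries (Fin (2 + 1)) k) ^ d +
              ∑ j : Fin d, rename (Fin.succAboveEmb (Fin.last 2)) (TupleGame.slice i₀ (X 0 * Bv j)) *
                X (Fin.last 2) ^ (j : ℕ)).order = d →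
            (∃ c₁ c₂ : Fin 3 → k, (∀ α β : k, α • c₁ + β • c₂ = 0 → α = 0 ∧ β = 0) ∧
              (∀ v : Fin 3 → k, CobordantChart.initEval (fun _ : Fin 3 => 1) (v + c₁) d
                ((X (Fin.last 2) : MvPowerSeries (Fin (2 + 1)) k) ^ d +
                  ∑ j : Fin d, rename (Fin.succAboveEmb (Fin.last 2)) (TupleGame.slice i₀ (X 0 * Bv j)) *
                    X (Fin.last 2) ^ (j : ℕ)) =
                CobordantChart.initEval (fun _ : Fin 3 => 1) v d
                ((X (Fin.last 2) : MvPowerSeries (Fin (2 + 1)) k) ^ d +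
                  ∑ j : Fin d, rename (Fin.succAboveEmb (Fin.last 2)) (TupleGame.slice i₀ (X 0 * Bv j)) *
                    X (Fin.last 2) ^ (j : ℕ))) ∧
              (∀ v : Fin 3 → k, CobordantChart.initEval (fun _ : Fin 3 => 1) (v + c₂) d
                ((X (Fin.last 2) : MvPowerSeries (Fin (2 + 1)) k) ^ d +
                  ∑ j : Fin d, rename (Fin.succAboveEmb (Fin.last 2)) (TupleGame.slice i₀ (X 0 * Bv j)) *
                    X (Fin.last 2) ^ (j : ℕ)) =
                CobordantChart.initEval (fun _ : Fin 3 => 1) v d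
                ((X (Fin.last 2) : MvPowerSeries (Fin (2 + 1)) k) ^ d +
                  ∑ j : Fin d, rename (Fin.succAboveEmb (Fin.last 2)) (TupleGame.slice i₀ (X 0 * Bv j)) *
                    X (Fin.last 2) ^ (j : ℕ)))) →
            ∀ μ' : Fin 2 → k,
              (∀ j : Fin d, ((d - (j : ℕ) : ℕ) : ℕ∞) <
                (shift d (fun j => TupleGame.slice i₀ (X 0 * Bv j)) (-(∑ i : Fin 2, C (μ' i) * X i)) j).order) →
              ∃ s' : S, germ s' = shift d (fun j => TupleGame.slice i₀ (X 0 * Bv j)) (-(∑ i : Fin 2, C (μ' i) * X i)) ∧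
                μ s' < μ s))) :
    ∀ s : S, (∀ j : Fin d, ((d - (j : ℕ) : ℕ) : ℕ∞) < (germ s j).order) →
      CobordantGame.Won k (2 + 1) ((X (Fin.last 2) : MvPowerSeries (Fin (2 + 1)) k) ^ d +
        ∑ j : Fin d, rename (Fin.succAboveEmb (Fin.last 2)) (germ s j) * X (Fin.last 2) ^ (j : ℕ)) := by
  classical
  suffices key : ∀ (α : Ordinal.{0}) (s : S), μ s = α → (∀ j : Fin d, ((d - (j : ℕ) : ℕ) : ℕ∞) < (germ s j).order) →
      Won k (2 + 1) ((X (Fin.last 2) : MvPowerSeries (Fin (2 + 1)) k) ^ d +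
        ∑ j : Fin d, rename (Fin.succAboveEmb (Fin.last 2)) (germ s j) * X (Fin.last 2) ^ (j : ℕ)) from
    fun s hs => key _ s rfl hs
  intro α
  induction α using WellFoundedLT.induction with
  | ind α ih =>
  intro s hα hs
  obtain ⟨θ, φ, hθ0, hθdet, hφ0, hA₁, hbr⟩ := hstep s hs
  -- the free moves: plane change, then re-centring
  rw [← won_monic_substX_iff θ hθ0 hθdet, ← won_monic_recentre_iff φ hφ0]
  set A₁ : Fin d → MvPowerSeries (Fin 2) k := shift d (fun j => subst θ (germ s j)) φ with hA₁def
  rcases hbr with hTA | hzero | hpt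
  · exact hT A₁ hA₁ hTA
  · -- the `d`-fold plane `y^d`: one move, no singular successor
    have hP : (X (Fin.last 2) : MvPowerSeries (Fin (2 + 1)) k) ^ d +
        ∑ j : Fin d, rename (Fin.succAboveEmb (Fin.last 2)) (A₁ j) * X (Fin.last 2) ^ (j : ℕ) = X (Fin.last 2) ^ d := by
      rw [Finset.sum_eq_zero, add_zero]
      intro j _
      rw [hzero j, map_zero, zero_mul]
    rw [hP]
    exact WildPurePower.won_X_pow_last 2 d
  · -- the point blow-up, live slot chosen by the datum; every singular successor is an exit or a smaller state
    refine won_monic_of_pointBlowup_slot p hp k 2 d hd A₁ hA₁ fun c hc Bv hBv => ?_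
    obtain ⟨i₀, hci₀, hpt⟩ := hpt c hc Bv hBv
    refine ⟨i₀, hci₀, fun hSs => ?_⟩
    set Tt : Fin d → MvPowerSeries (Fin 2) k := fun j => TupleGame.slice i₀ (X 0 * Bv j) with hTt
    set Sg : MvPowerSeries (Fin (2 + 1)) k := (X (Fin.last 2) : MvPowerSeries (Fin (2 + 1)) k) ^ d +
      ∑ j : Fin d, rename (Fin.succAboveEmb (Fin.last 2)) (Tt j) * X (Fin.last 2) ^ (j : ℕ) with hSg
    by_cases hlt : Sg.order < (d : ℕ)
    · exact hord _ hSs hlt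
    rw [not_lt] at hlt
    have hSo : Sg.order = d := le_antisymm (order_monicForm_le Tt) hlt
    by_cases hwide : ∃ c₁ c₂ : Fin 3 → k, (∀ α β : k, α • c₁ + β • c₂ = 0 → α = 0 ∧ β = 0) ∧
        (∀ v : Fin 3 → k, CobordantChart.initEval (fun _ : Fin 3 => 1) (v + c₁) d Sg =
          CobordantChart.initEval (fun _ : Fin 3 => 1) v d Sg) ∧
        (∀ v : Fin 3 → k, CobordantChart.initEval (fun _ : Fin 3 => 1) (v + c₂) d Sg =
          CobordantChart.initEval (fun _ : Fin 3 => 1) v d Sg)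
    · -- wide apex: re-centre linearly to a position, which is a smaller state
      obtain ⟨c₁, c₂, hind, h₁, h₂⟩ := hwide
      obtain ⟨μ', hpos⟩ := exists_linShift_isPos_of_wide k hd Tt hlt c₁ c₂ hind h₁ h₂
      obtain ⟨s', hs', hμ⟩ := hpt hSs hSo ⟨c₁, c₂, hind, h₁, h₂⟩ μ' hpos
      have hφ'0 : constantCoeff (-(∑ i : Fin 2, C (μ' i) * X i) : MvPowerSeries (Fin 2) k) = 0 := by
        rw [map_neg, map_sum, Finset.sum_eq_zero, neg_zero]
        intro i _
        rw [map_mul, constantCoeff_X, mul_zero]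
      rw [hSg, ← won_monic_recentre_iff (-(∑ i : Fin 2, C (μ' i) * X i)) hφ'0 Tt, ← hs']
      exact ih (μ s') (hα ▸ hμ) s' rfl (by rw [hs']; exact hpos)
    · -- not wide: apex-free or axis
      exact WildPurePower.won_of_order_eq_of_not_wide p hp k hord haxis _ hSs hSo hwide


/-! ### S3ρ from the pieces: terminal classes + descent datum -/

/-- S3ρ `stub_wildMonicSurfaceReductionWon` VERBATIM FROM THE PIECES, SECOND FORM (see `monic_won_of_descent₂`): a TERMINAL
PREDICATE `Term` with its winning theorem (S3ρT) and a DESCENT DATUM (S3ρD₂) covering every position, with the step property relative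
to the exits «`Term`», «pure `p^e`-th power form», «zero tuple», and the slot-choosing point blow-up. -/
theorem wildMonicSurfaceReductionWon_of_descent₂
    (Term : ∀ (k : Type) [Field k] (d : ℕ), (Fin d → MvPowerSeries (Fin 2) k) → Prop)
    (hterm : ∀ (p : ℕ), p.Prime → ∀ (k : Type) [Field k] [CharP k p] [IsAlgClosed k],
      ∀ (d : ℕ), p ∣ d → 2 < d →
      (∀ g : MvPowerSeries (Fin 3) k, CobordantGame.IsSingular k g → g.order < d →
        CobordantGame.Won k 3 g) →
      (∀ g : MvPowerSeries (Fin 3) k, CobordantGame.IsSingular k g → g.order = d →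
        (∃ c : Fin 3 → k, c ≠ 0 ∧ ∀ v : Fin 3 → k,
          CobordantChart.initEval (fun _ : Fin 3 => 1) (v + c) d g =
            CobordantChart.initEval (fun _ : Fin 3 => 1) v d g) →
        (∀ c₁ c₂ : Fin 3 → k,
          (∀ v : Fin 3 → k, CobordantChart.initEval (fun _ : Fin 3 => 1) (v + c₁) d g =
            CobordantChart.initEval (fun _ : Fin 3 => 1) v d g) →
          (∀ v : Fin 3 → k, CobordantChart.initEval (fun _ : Fin 3 => 1) (v + c₂) d g =
            CobordantChart.initEval (fun _ : Fin 3 => 1) v d g) →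
          ∃ α β : k, (α ≠ 0 ∨ β ≠ 0) ∧ α • c₁ + β • c₂ = 0) →
        CobordantGame.Won k 3 g) →
      ∀ A : Fin d → MvPowerSeries (Fin 2) k, (∀ j : Fin d, ((d - (j : ℕ) : ℕ) : ℕ∞) < (A j).order) → Term k d A →
        CobordantGame.Won k 3 (MvPowerSeries.X (Fin.last 2) ^ d +
          ∑ j : Fin d, MvPowerSeries.rename (Fin.succAboveEmb (Fin.last 2)) (A j) * MvPowerSeries.X (Fin.last 2) ^ (j : ℕ)))
    (hdesc : ∀ (p : ℕ), p.Prime → ∀ (k : Type) [Field k] [CharP k p] [IsAlgClosed k],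
      (∀ m : ℕ, m < 3 → ∀ g : MvPowerSeries (Fin m) k,
        CobordantGame.IsSingular k g → CobordantGame.Won k m g) →
      ∀ (d : ℕ), p ∣ d → 2 < d →
      (∀ g : MvPowerSeries (Fin 3) k, CobordantGame.IsSingular k g → g.order < d →
        CobordantGame.Won k 3 g) →
      (∀ g : MvPowerSeries (Fin 3) k, CobordantGame.IsSingular k g → g.order = d →
        (∃ c : Fin 3 → k, c ≠ 0 ∧ ∀ v : Fin 3 → k,
          CobordantChart.initEval (fun _ : Fin 3 => 1) (v + c) d g =
            CobordantChart.initEval (fun _ : Fin 3 => 1) v d g) →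
        (∀ c₁ c₂ : Fin 3 → k,
          (∀ v : Fin 3 → k, CobordantChart.initEval (fun _ : Fin 3 => 1) (v + c₁) d g =
            CobordantChart.initEval (fun _ : Fin 3 => 1) v d g) →
          (∀ v : Fin 3 → k, CobordantChart.initEval (fun _ : Fin 3 => 1) (v + c₂) d g =
            CobordantChart.initEval (fun _ : Fin 3 => 1) v d g) →
          ∃ α β : k, (α ≠ 0 ∨ β ≠ 0) ∧ α • c₁ + β • c₂ = 0) →
        CobordantGame.Won k 3 g) →
      ∃ (S : Type) (germ : S → Fin d → MvPowerSeries (Fin 2) k) (μ : S → Ordinal.{0}),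
        (∀ A : Fin d → MvPowerSeries (Fin 2) k, (∀ j : Fin d, ((d - (j : ℕ) : ℕ) : ℕ∞) < (A j).order) →
          ∃ s, germ s = A) ∧
        (∀ s : S, (∀ j : Fin d, ((d - (j : ℕ) : ℕ) : ℕ∞) < (germ s j).order) →
          ∃ (θ : Fin 2 → MvPowerSeries (Fin 2) k) (φ : MvPowerSeries (Fin 2) k),
            (∀ i, constantCoeff (θ i) = 0) ∧ IsUnit (FormalCoordChange.linMat θ).det ∧ constantCoeff φ = 0 ∧
            (∀ j : Fin d, ((d - (j : ℕ) : ℕ) : ℕ∞) < (shift d (fun j => subst θ (germ s j)) φ j).order) ∧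
            ((Term k d (shift d (fun j => subst θ (germ s j)) φ) ∨
              ((∃ e : ℕ, d = p ^ e) ∧ ∀ j : Fin d, (j : ℕ) ≠ 0 → shift d (fun j => subst θ (germ s j)) φ j = 0)) ∨
              (∀ j : Fin d, shift d (fun j => subst θ (germ s j)) φ j = 0) ∨
              ∀ (c : Fin 2 → k), (∃ i, c i ≠ 0) → ∀ Bv : Fin d → MvPowerSeries (Fin (2 + 1)) k,
                (∀ j : Fin d, subst (CobordantChart.chart (fun _ : Fin 2 => 1) c)
                  (shift d (fun j => subst θ (germ s j)) φ j) = X 0 ^ (d - (j : ℕ) + 1) * Bv j) →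
                ∃ i₀ : Fin 2, c i₀ ≠ 0 ∧
                (CobordantGame.IsSingular k ((X (Fin.last 2) : MvPowerSeries (Fin (2 + 1)) k) ^ d +
                  ∑ j : Fin d, rename (Fin.succAboveEmb (Fin.last 2)) (TupleGame.slice i₀ (X 0 * Bv j)) *
                    X (Fin.last 2) ^ (j : ℕ)) →
                ((X (Fin.last 2) : MvPowerSeries (Fin (2 + 1)) k) ^ d +
                  ∑ j : Fin d, rename (Fin.succAboveEmb (Fin.last 2)) (TupleGame.slice i₀ (X 0 * Bv j)) *
                    X (Fin.last 2) ^ (j : ℕ)).order = d →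
                (∃ c₁ c₂ : Fin 3 → k, (∀ α β : k, α • c₁ + β • c₂ = 0 → α = 0 ∧ β = 0) ∧
                  (∀ v : Fin 3 → k, CobordantChart.initEval (fun _ : Fin 3 => 1) (v + c₁) d
                    ((X (Fin.last 2) : MvPowerSeries (Fin (2 + 1)) k) ^ d +
                      ∑ j : Fin d, rename (Fin.succAboveEmb (Fin.last 2)) (TupleGame.slice i₀ (X 0 * Bv j)) *
                        X (Fin.last 2) ^ (j : ℕ)) =
                    CobordantChart.initEval (fun _ : Fin 3 => 1) v d
                    ((X (Fin.last 2) : MvPowerSeries (Fin (2 + 1)) k) ^ d +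
                      ∑ j : Fin d, rename (Fin.succAboveEmb (Fin.last 2)) (TupleGame.slice i₀ (X 0 * Bv j)) *
                        X (Fin.last 2) ^ (j : ℕ))) ∧
                  (∀ v : Fin 3 → k, CobordantChart.initEval (fun _ : Fin 3 => 1) (v + c₂) d
                    ((X (Fin.last 2) : MvPowerSeries (Fin (2 + 1)) k) ^ d +
                      ∑ j : Fin d, rename (Fin.succAboveEmb (Fin.last 2)) (TupleGame.slice i₀ (X 0 * Bv j)) *
                        X (Fin.last 2) ^ (j : ℕ)) =
                    CobordantChart.initEval (fun _ : Fin 3 => 1) v d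
                    ((X (Fin.last 2) : MvPowerSeries (Fin (2 + 1)) k) ^ d +
                      ∑ j : Fin d, rename (Fin.succAboveEmb (Fin.last 2)) (TupleGame.slice i₀ (X 0 * Bv j)) *
                        X (Fin.last 2) ^ (j : ℕ)))) →
                ∀ μ' : Fin 2 → k,
                  (∀ j : Fin d, ((d - (j : ℕ) : ℕ) : ℕ∞) <
                    (shift d (fun j => TupleGame.slice i₀ (X 0 * Bv j)) (-(∑ i : Fin 2, C (μ' i) * X i)) j).order) →
                  ∃ s' : S, germ s' = shift d (fun j => TupleGame.slice i₀ (X 0 * Bv j))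
                      (-(∑ i : Fin 2, C (μ' i) * X i)) ∧ μ s' < μ s)))) :
    ∀ (p : ℕ), p.Prime → ∀ (k : Type) [Field k] [CharP k p] [IsAlgClosed k],
      (∀ m : ℕ, m < 3 → ∀ g : MvPowerSeries (Fin m) k,
        CobordantGame.IsSingular k g → CobordantGame.Won k m g) →
      ∀ (d : ℕ), p ∣ d → 2 < d →
      (∀ g : MvPowerSeries (Fin 3) k, CobordantGame.IsSingular k g → g.order < d →
        CobordantGame.Won k 3 g) →
      (∀ g : MvPowerSeries (Fin 3) k, CobordantGame.IsSingular k g → g.order = d →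
        (∃ c : Fin 3 → k, c ≠ 0 ∧ ∀ v : Fin 3 → k,
          CobordantChart.initEval (fun _ : Fin 3 => 1) (v + c) d g =
            CobordantChart.initEval (fun _ : Fin 3 => 1) v d g) →
        (∀ c₁ c₂ : Fin 3 → k,
          (∀ v : Fin 3 → k, CobordantChart.initEval (fun _ : Fin 3 => 1) (v + c₁) d g =
            CobordantChart.initEval (fun _ : Fin 3 => 1) v d g) →
          (∀ v : Fin 3 → k, CobordantChart.initEval (fun _ : Fin 3 => 1) (v + c₂) d g =
            CobordantChart.initEval (fun _ : Fin 3 => 1) v d g) →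
          ∃ α β : k, (α ≠ 0 ∨ β ≠ 0) ∧ α • c₁ + β • c₂ = 0) →
        CobordantGame.Won k 3 g) →
      ((∃ e : ℕ, d = p ^ e) → ∀ (A₀ : MvPowerSeries (Fin 2) k), (d : ℕ∞) < A₀.order →
        CobordantGame.Won k 3 (MvPowerSeries.X (Fin.last 2) ^ d +
          MvPowerSeries.rename (Fin.succAboveEmb (Fin.last 2)) A₀)) →
      ∀ A : Fin d → MvPowerSeries (Fin 2) k, (∀ j : Fin d, ((d - (j : ℕ) : ℕ) : ℕ∞) < (A j).order) →
        CobordantGame.Won k 3 (MvPowerSeries.X (Fin.last 2) ^ d +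
          ∑ j : Fin d, MvPowerSeries.rename (Fin.succAboveEmb (Fin.last 2)) (A j) * MvPowerSeries.X (Fin.last 2) ^ (j : ℕ)) := by
  intro p hp k _ _ _ hlow d hpd h2d hord haxis hpure A hA
  have hd : 0 < d := by omega
  obtain ⟨S, germ, μ, hcover, hstep⟩ := hdesc p hp k hlow d hpd h2d hord haxis
  obtain ⟨s, hs⟩ := hcover A hA
  rw [← hs]
  refine monic_won_of_descent₂ p hp k hd hord haxis
    (fun A => Term k d A ∨ ((∃ e : ℕ, d = p ^ e) ∧ ∀ j : Fin d, (j : ℕ) ≠ 0 → A j = 0)) ?_ germ μ ?_ s (by rw [hs]; exact hA)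
  · -- the exits: terminal classes (S3ρT) and the pure `p^e`-th power forms (hypothesis of S3ρ)
    intro B hB hT
    rcases hT with hTB | ⟨hpe, hpureB⟩
    · exact hterm p hp k d hpd h2d hord haxis B hB hTB
    · rw [monicForm_eq_purePower hd B hpureB]
      have h0 := hB ⟨0, hd⟩
      rw [Nat.sub_zero] at h0
      exact hpure hpe (B ⟨0, hd⟩) h0
  · intro s' hs'
    obtain ⟨θ, φ, hθ0, hθdet, hφ0, hA₁, hbr⟩ := hstep s' hs'
    refine ⟨θ, φ, hθ0, hθdet, hφ0, hA₁, ?_⟩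
    rcases hbr with (hT | hP) | hZ | hpt
    · exact Or.inl (Or.inl hT)
    · exact Or.inl (Or.inr hP)
    · exact Or.inr (Or.inl hZ)
    · exact Or.inr (Or.inr hpt)

end WildMonic

end Summit.ResolutionOfSingularities.ResolutionOfSingularities.Theorems
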